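import Summits.QuantumFields.YangMills.Theorems.PoincareLipschitzMassRowsOfDeepLowCharts
import Summits.QuantumFields.YangMills.Theorems.PoincareLipschitzLevelOneLipschitz
import Summits.QuantumFields.YangMills.Theses.PoincareLipschitz
import HarnessLib

/-!
# Crux stmt-QuantumFields-19936 `UnitScaleTilt.HistoryTailL`, route crux `PoincareLipschitz.BlockLipschitzL` (stmt-QuantumFields-23533) BY NAME,
# MODULO THE ORGAN: `BlockLipschitzL ⟸ per-bond charts at the LOW levels of the per-level box-ℓ²-orbit minimisers, for DEEP pairs`

Cell `ym3-torus` (YM ladder rung R3 = continuum SU(2) Yang–Mills on the three-torus — a RUNG, NOT the Clay problem: not d = 4, not infinite volume,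
not a mass gap); width seat `ym-ust-19936-w2` g11, F6 pen (LEAD `ym-ust-19936-w1` g7, card v1.33 (c)).  Helper `--supports stmt-QuantumFields-19936`;
THEOREMS ONLY (0 `def`, 0 `sorry`).  CONDITIONAL: the displayed hypothesis `hDeep` (the «multiscale Coulomb chart», card v1.33's named organ M-COUL +
★w3's S-ALIGN) is NOT proved here or anywhere in the tree; this file does NOT close stmt-QuantumFields-23533.

THE CERTIFICATE.  The registered skeleton `Cruxes/HistoryTailL/Lines/poincare_lipschitz.lean` composes `BlockLipschitzL` from the two depth ranges
`stub_levelOneLipschitz` (`j = 1`, PROVED: ✓`PoincareLipschitzLevelOneLipschitz.stub_levelOneLipschitz`, p674322) and `stub_iteratedLipschitz` (`j ≥ 2`).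
The F6 chain of this seat gives the latter VERBATIM from the deep low-level charts — ✓`PoincareLipschitzMassRowsOfDeepLowCharts.stub_iteratedLipschitz_of_deepLowCharts`
(p692076) ∘ LOWCHART (p691443) ∘ CHART (p690785) ∘ KNIT (p690145) ∘ IND (p689173) ∘ LEAD's STEP-MASS (p688053) ∘ the hStab⋆ door (p683030 ∘ p682224 ∘ p681042 ∘
p679967).  Merging the two ranges exactly as ✓`PoincareLipschitzBlockLipschitzOfAvgStability.blockLipschitzL_of_avgStabilityModGauge` (p680477) does
(`CL := max CL₁ CL₂`, `γ₁ := min γ₁ γ₂`) yields the route crux BY NAME modulo `hDeep`.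

WHAT IS PROVED (ns `…Theorems.PoincareLipschitzBlockLipschitzLOfDeepLowCharts`).
* ★★★ `blockLipschitzL_of_deepLowCharts (hDeep) : Summit.QuantumFields.YangMills.Theses.PoincareLipschitz.BlockLipschitzL`.
HONEST SCOPE.  A 20-line merge; `hDeep` displayed (frozen text: HOME `ym-ust-19936-w2/g11/FROZEN-F6-DEEPLOWCHARTS-hypothesis.w2g11.lean.txt`).  What `hDeep`
asks (T3 letters): for every `L` a nearness constant `T > 0` and, for all thresholds, `γ₂ > 0`, such that every locally hierarchically good, box-orbit-minimising,
`T`-near pair at a DEEP depth (`K < 3(j+1)`) admits a monotone margin schedule `m` and charts `σ_i` (`σ_i ≤ (2·10⁷L⁴)⁻¹`, `Σσ_i ≤ (2·10⁷L⁷)⁻¹`) bounding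
`‖pertVar (Ū^iU) ((Ū^iU')^h) b‖ ≤ σ_i` on the two-block neighbourhoods of `S_{i+1}[m]` for every box-`ℓ²`-orbit-minimising level-`i` gauge copy `(Ū^iU')^h`
with `Σ_{S_i[m]}‖pertVar‖² ≤ 4L^{−i}Bx`, at every LOW level `((10⁸L⁷)⁻¹)²(4∕9)^i < 4L^{−i}Bx`.  YM₃ on T³ is rung R3, not Clay; YM gap NOT proved.

References: T. Bałaban, CMP 109 (1987) 249–301 [Balaban1987RG1] ((0.4) p.253); CMP 98 (1985) 17–51 [Balaban1985Averaging] (Props 1–3 (122)–(126) p.36).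
-/

noncomputable section

open scoped BigOperators Matrix.Norms.L2Operator

namespace Summit.QuantumFields.YangMills.Theorems.PoincareLipschitzBlockLipschitzLOfDeepLowCharts

open Literature.MathematicalPhysics.QuantumFieldTheory.Balaban1983to89
open Literature.MathematicalPhysics.QuantumFieldTheory.Balaban1983to89.T3ContinuumYM3Torus
open Summit.QuantumFields.YangMills.Theorems.PoincareLipschitzLevelOneLipschitz (stub_levelOneLipschitz)
open Summit.QuantumFields.YangMills.Theorems.PoincareLipschitzMassRowsOfDeepLowCharts (stub_iteratedLipschitz_of_deepLowCharts)

/-- ★★★ **`BlockLipschitzL` ⟸ THE DEEP LOW-LEVEL CHARTS** (stmt-QuantumFields-23533 by name, modulo the organ): the `j = 1` rung is ✓`stub_levelOneLipschitz`,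
the `j ≥ 2` rung is ✓`stub_iteratedLipschitz_of_deepLowCharts hDeep`; merged with `CL := max CL₁ CL₂`, `γ₁ := min γ₁ γ₂` as in the registered skeleton's
`BlockLipschitzL_of` ∕ ✓p680477. [cite: Balaban1987RG1, (0.4) p.253; Balaban1985Averaging, Prop. 3 (122)-(126) p.36] -/
theorem blockLipschitzL_of_deepLowCharts
    (hDeep : open Literature.MathematicalPhysics.QuantumFieldTheory.Balaban1983to89 Literature.MathematicalPhysics.QuantumFieldTheory.Balaban1983to89.T3ContinuumYM3Torus in ∀ (L : ℕ), ∃ T : ℝ, 0 < T ∧ ∀ (b₀ p₀ : ℝ), 0 < b₀ → 2 < p₀ → ∃ γ₂ : ℝ, 0 < γ₂ ∧ ∀ (F : T3Family) (γ : ℝ), F.L = L → 0 < γ → γ ≤ γ₂ → ∀ (K j : ℕ), 1 ≤ j → j + 3 ≤ K → K < 3 * (j + 1) → ∀ (a : Plaq (F.P K) (j + 1)) (U U' : GaugeField (F.P K) 0 (Matrix.specialUnitaryGroup (Fin 2) ℂ)), (∀ (i : ℕ) (q : Plaq (F.P K) i), i < j + 1 → Site.tdist (fun k => ((((q.src k).val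 * F.L ^ i : ℕ)) : ZMod ((F.P K).sitesPerDir 0))) (fun k => ((((a.src k).val * F.L ^ (j + 1) : ℕ)) : ZMod ((F.P K).sitesPerDir 0))) + 64 * F.L ^ i ≤ 64 * F.L ^ (j + 1) → GaugeGroup.dist1 (GaugeField.plaqHol (Averaging.iter (fun i' => BlockAveraging.blockAvg (P := F.P K) (j := i') T3UnitLawDensityEML.ℰp) i U) q) < T3UnitScaleTilt.θBal F.L γ b₀ p₀ (K - i)) → (∀ (i : ℕ) (q : Plaq (F.P K) i), i < j + 1 → Site.tdist (fun k => ((((q.src k).val * F.L ^ i : ℕ)) : ZMod ((F.P K).sitesPerDir 0))) (fun k => ((((a.src k).val * F.L ^ (j + 1) : ℕ)) : ZMod ((F.P K).sitesPerDir 0))) + 64 * F.L ^ i ≤ 64 * F.L ^ (j + 1) → GaugeGroup.dist1 (GaugeField.plaqHol (Averaging.iter (fun i' => BlockAveraging.blockAvg (P := F.P K) (j := i') T3UnitLawDensityEML.ℰp) i U') q) < T3UnitScaleTilt.θBal F.L γ b₀ p₀ (K - i)) → (∀ k : GaugeTransf (F.P K) 0 (Matrix.specialUnitaryGroup (Fin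 2) ℂ), (∑ b : PBond (F.P K) 0, if (∀ k, (b.src k - ((((a.src k).val * F.L ^ (j + 1) : ℕ)) : ZMod ((F.P K).sitesPerDir 0)) + ((8 * F.L ^ (j + 1) : ℕ) : ZMod ((F.P K).sitesPerDir 0))).val < 17 * F.L ^ (j + 1)) ∧ (∀ k, (b.tgt k - ((((a.src k).val * F.L ^ (j + 1) : ℕ)) : ZMod ((F.P K).sitesPerDir 0)) + ((8 * F.L ^ (j + 1) : ℕ) : ZMod ((F.P K).sitesPerDir 0))).val < 17 * F.L ^ (j + 1)) then GaugeGroup.dist1 (U b * (U' b)⁻¹) ^ 2 else 0) ≤ (∑ b : PBond (F.P K) 0, if (∀ k, (b.src k - ((((a.src k).val * F.L ^ (j + 1) : ℕ)) : ZMod ((F.P K).sitesPerDir 0)) + ((8 * F.L ^ (j + 1) : ℕ) : ZMod ((F.P K).sitesPerDir 0))).val < 17 * F.L ^ (j + 1)) ∧ (∀ k, (b.tgt k - ((((a.src k).val * F.L ^ (j + 1) : ℕ)) : ZMod ((F.P K).sitesPerDir 0)) + ((8 * F.L ^ (j + 1) : ℕ) : ZMod ((F.P K).sitesPerDir 0))).val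 < 17 * F.L ^ (j + 1)) then GaugeGroup.dist1 (U b * (GaugeField.gaugeAct k U' b)⁻¹) ^ 2 else 0)) → Real.sqrt (∑ b : PBond (F.P K) 0, if (∀ k, (b.src k - ((((a.src k).val * F.L ^ (j + 1) : ℕ)) : ZMod ((F.P K).sitesPerDir 0)) + ((8 * F.L ^ (j + 1) : ℕ) : ZMod ((F.P K).sitesPerDir 0))).val < 17 * F.L ^ (j + 1)) ∧ (∀ k, (b.tgt k - ((((a.src k).val * F.L ^ (j + 1) : ℕ)) : ZMod ((F.P K).sitesPerDir 0)) + ((8 * F.L ^ (j + 1) : ℕ) : ZMod ((F.P K).sitesPerDir 0))).val < 17 * F.L ^ (j + 1)) then GaugeGroup.dist1 (U b * (U' b)⁻¹) ^ 2 else 0) ≤ T * Real.sqrt ((F.L : ℝ) ^ (j + 1)) * T3UnitScaleTilt.θBal F.L γ b₀ p₀ (K - j) → ∃ m : ℕ → ℕ, (∀ i, m i ≤ m (i + 1)) ∧ m j ≤ F.L ^ (j + 1) ∧ ∃ σ : ℕ → ℝ, (∀ i, i < j → 0 ≤ σ i ∧ σ i ≤ 1 / (2 * 10 ^ 7 * (L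 : ℝ) ^ 4)) ∧ (∑ i ∈ Finset.range j, σ i ≤ 1 / (2 * 10 ^ 7 * (L : ℝ) ^ 7)) ∧ ∀ i, i < j → ∀ h : GaugeTransf (F.P K) i (Matrix.specialUnitaryGroup (Fin 2) ℂ), (∀ k' : GaugeTransf (F.P K) i (Matrix.specialUnitaryGroup (Fin 2) ℂ), (∑ b : PBond (F.P K) i, if b ∈ Finset.univ.filter (fun b : PBond (F.P K) i => Site.tdist (fun k => ((((b.src k).val * F.L ^ i : ℕ)) : ZMod ((F.P K).sitesPerDir 0))) (fun k => ((((a.src k).val * F.L ^ (j + 1) : ℕ)) : ZMod ((F.P K).sitesPerDir 0))) + 2 * F.L ^ (i + 1) + m i ≤ 8 * F.L ^ (j + 1)) then GaugeGroup.dist1 (Averaging.iter (fun i' => BlockAveraging.blockAvg (P := F.P K) (j := i') T3UnitLawDensityEML.ℰp) i U b * (GaugeField.gaugeAct h (Averaging.iter (fun i' => BlockAveraging.blockAvg (P := F.P K) (j := i') T3UnitLawDensityEML.ℰp) i U') b)⁻¹) ^ 2 else 0) ≤ ∑ b : PBond (F.P K) i, if b ∈ Finset.univ.filter (fun b : PBond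 (F.P K) i => Site.tdist (fun k => ((((b.src k).val * F.L ^ i : ℕ)) : ZMod ((F.P K).sitesPerDir 0))) (fun k => ((((a.src k).val * F.L ^ (j + 1) : ℕ)) : ZMod ((F.P K).sitesPerDir 0))) + 2 * F.L ^ (i + 1) + m i ≤ 8 * F.L ^ (j + 1)) then GaugeGroup.dist1 (Averaging.iter (fun i' => BlockAveraging.blockAvg (P := F.P K) (j := i') T3UnitLawDensityEML.ℰp) i U b * (GaugeField.gaugeAct k' (GaugeField.gaugeAct h (Averaging.iter (fun i' => BlockAveraging.blockAvg (P := F.P K) (j := i') T3UnitLawDensityEML.ℰp) i U')) b)⁻¹) ^ 2 else 0) → ∑ b ∈ Finset.univ.filter (fun b : PBond (F.P K) i => Site.tdist (fun k => ((((b.src k).val * F.L ^ i : ℕ)) : ZMod ((F.P K).sitesPerDir 0))) (fun k => ((((a.src k).val * F.L ^ (j + 1) : ℕ)) : ZMod ((F.P K).sitesPerDir 0))) + 2 * F.L ^ (i + 1) + m i ≤ 8 * F.L ^ (j + 1)), ‖BlockAveragingEMLLinearisedBackground.pertVar (Averaging.iter (fun i' => BlockAveraging.blockAvg (P := F.P K)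 (j := i') T3UnitLawDensityEML.ℰp) i U) (GaugeField.gaugeAct h (Averaging.iter (fun i' => BlockAveraging.blockAvg (P := F.P K) (j := i') T3UnitLawDensityEML.ℰp) i U')) b‖ ^ 2 ≤ 4 * ((F.L : ℝ) ^ i)⁻¹ * (∑ b : PBond (F.P K) 0, if (∀ k, (b.src k - ((((a.src k).val * F.L ^ (j + 1) : ℕ)) : ZMod ((F.P K).sitesPerDir 0)) + ((8 * F.L ^ (j + 1) : ℕ) : ZMod ((F.P K).sitesPerDir 0))).val < 17 * F.L ^ (j + 1)) ∧ (∀ k, (b.tgt k - ((((a.src k).val * F.L ^ (j + 1) : ℕ)) : ZMod ((F.P K).sitesPerDir 0)) + ((8 * F.L ^ (j + 1) : ℕ) : ZMod ((F.P K).sitesPerDir 0))).val < 17 * F.L ^ (j + 1)) then GaugeGroup.dist1 (U b * (U' b)⁻¹) ^ 2 else 0) → (1 / (10 ^ 8 * (L : ℝ) ^ 7)) ^ 2 * (4 / 9) ^ i < 4 * ((F.L : ℝ) ^ i)⁻¹ * (∑ b : PBond (F.P K) 0, if (∀ k, (b.src k - ((((a.src k).val * F.L ^ (j + 1) : ℕ))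 : ZMod ((F.P K).sitesPerDir 0)) + ((8 * F.L ^ (j + 1) : ℕ) : ZMod ((F.P K).sitesPerDir 0))).val < 17 * F.L ^ (j + 1)) ∧ (∀ k, (b.tgt k - ((((a.src k).val * F.L ^ (j + 1) : ℕ)) : ZMod ((F.P K).sitesPerDir 0)) + ((8 * F.L ^ (j + 1) : ℕ) : ZMod ((F.P K).sitesPerDir 0))).val < 17 * F.L ^ (j + 1)) then GaugeGroup.dist1 (U b * (U' b)⁻¹) ^ 2 else 0) → ∀ c ∈ Finset.univ.filter (fun b : PBond (F.P K) (i + 1) => Site.tdist (fun k => ((((b.src k).val * F.L ^ (i + 1) : ℕ)) : ZMod ((F.P K).sitesPerDir 0))) (fun k => ((((a.src k).val * F.L ^ (j + 1) : ℕ)) : ZMod ((F.P K).sitesPerDir 0))) + 2 * F.L ^ (i + 1 + 1) + m (i + 1) ≤ 8 * F.L ^ (j + 1)), ∀ b ∈ Finset.univ.filter (fun b : PBond (F.P K) i => blockOf b.src = c.src ∨ blockOf b.src = c.tgt), ‖BlockAveragingEMLLinearisedBackground.pertVar (Averaging.iter (fun i' => BlockAveraging.blockAvg (P := F.P K) (j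 := i') T3UnitLawDensityEML.ℰp) i U) (GaugeField.gaugeAct h (Averaging.iter (fun i' => BlockAveraging.blockAvg (P := F.P K) (j := i') T3UnitLawDensityEML.ℰp) i U')) b‖ ≤ σ i) :
    Summit.QuantumFields.YangMills.Theses.PoincareLipschitz.BlockLipschitzL := by
  have hA := stub_levelOneLipschitz
  have hB := stub_iteratedLipschitz_of_deepLowCharts hDeep
  intro L
  obtain ⟨C1, hC1, HA⟩ := hA L
  obtain ⟨C2, hC2, HB⟩ := hB L
  refine ⟨max C1 C2, le_max_of_le_left hC1, ?_⟩
  intro b₀ p₀ hb hp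
  obtain ⟨γa, hγa, hγa1, HA'⟩ := HA b₀ p₀ hb hp
  obtain ⟨γb, hγb, hγb1, HB'⟩ := HB b₀ p₀ hb hp
  refine ⟨min γa γb, lt_min hγa hγb, (min_le_left _ _).trans hγa1, ?_⟩
  intro F γ hFL hγ hγ1 K j hj hjK a U U' hU hU'
  by_cases hcase : j ≤ 1
  · have h := HA' F γ hFL hγ (hγ1.trans (min_le_left γa γb)) K j hj hjK hcase a U U' hU hU'
    refine h.trans (mul_le_mul_of_nonneg_right ?_ (Real.sqrt_nonneg _))
    exact div_le_div_of_nonneg_right (le_max_left _ _) (Real.sqrt_nonneg _)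
  · have h := HB' F γ hFL hγ (hγ1.trans (min_le_right γa γb)) K j hj hjK (by omega) a U U' hU hU'
    refine h.trans (mul_le_mul_of_nonneg_right ?_ (Real.sqrt_nonneg _))
    exact div_le_div_of_nonneg_right (le_max_right _ _) (Real.sqrt_nonneg _)

end Summit.QuantumFields.YangMills.Theorems.PoincareLipschitzBlockLipschitzLOfDeepLowCharts

end
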